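import Mathlib.RingTheory.Flat.Basic
import Mathlib.RingTheory.TensorProduct.MonoidAlgebra
import Mathlib.LinearAlgebra.TensorProduct.RightExactness
import Mathlib.RingTheory.Ideal.Colon
import Literature.AlgebraicGeometry.Resolution.WeightedResolutionDatum
import Summits.ResolutionOfSingularities.ResolutionOfSingularities.Theorems.WeightedInvariantWeightedConstructionExtReesLocalization
import Summits.ResolutionOfSingularities.ResolutionOfSingularities.Theorems.WeightedInvariantWeightedConstructionStrictTransformLocalization

/-!
# Extended Rees algebras base-change along flat algebras (crux `WeightedConstruction`, stub R3a)

Route `ResolutionOfSingularities/WeightedInvariant`, crux `WeightedConstruction`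
(stmt-ResolutionOfSingularities-0571), line `support-first-weights-second`, stub
`stub_extReesAlgebra_baseChange`.

Setting: `A → A'` a FLAT algebra, `I : ℕ → Ideal A`, `I'ₙ = Iₙ A'`, `S = A[t⁻¹, Iₙ tⁿ] =
extReesAlgebra I ⊆ A[t, t⁻¹]`, `S' = A'[t⁻¹, I'ₙ tⁿ] = extReesAlgebra I' ⊆ A'[t, t⁻¹]`, `s = t⁻¹`.
The line reduces the crux to pre-data whose drop axiom is checked over algebraically closed
ground fields; the passage `k → K = k̄` base-changes the full cobordant blow-up
`B(U) = Spec Γ(U)[t⁻¹, Iₙ tⁿ]` (Włodarczyk, arXiv:2203.03090, Def. 2.3.5; quasi-coherent in `U`,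
App. Def. 5.1.1) along the flat algebra `Γ(U) → Γ(U) ⊗ₖ K`. This file is the ring statement:

1. the base change of Laurent polynomials restricts to `ψ : S →+* S'` (construction copied from
   `stub_extReesAlgebra_localization`, via `extReesLoc_mapRingHom_mem`);
2. `ψ` lies over `A → A'` and 3. fixes `t⁻¹` (`strictTransformLoc_map_algebraMap`,
   `strictTransformLoc_map_tInv`);
4. `(vertexIdeal I) S' = vertexIdeal I'`: `≤` is `strictTransformLoc_vertexIdeal_map_le`; for `≥`
   a generator `a' tⁿ` with `a' ∈ Iₙ A' = A'-span of the image of Iₙ` is an `A'`-combination of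
   the `ψ (a tⁿ)` (span induction, `extReesBC_mem_of_coe_eq`) — no flatness needed;
5. `σˢ(𝔞) S' = σˢ(𝔞 A')` for every ideal `𝔞 ≤ A` (`σˢ` = `t⁻¹`-saturation of the extended
   ideal, `extReesAlgebra.mem_strictTransform_iff`): `≤` is
   `strictTransformLoc_strictTransform_map_le`; `≥` NEEDS FLATNESS: colon ideals by `sᵐ`
   commute with the flat base change `S → S' = A' ⊗[A] S`. Abstractly
   (`extReesBC_mem_range_lTensor_comap_iff`): for a flat module `M`, a linear endomorphism `f`
   of `N` and `J ≤ N`, tensoring the exact sequence `0 → f⁻¹J → N → N/J` (`Module.Flat.lTensor_exact`)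
   and right exactness (`lTensor_mkQ`) give `M ⊗ f⁻¹J = {z | (1 ⊗ f) z ∈ im (M ⊗ J)}`; with
   `Ideal.map_includeRight_eq` this is the statement for ideals of `R' ⊗[R] B`
   (`extReesBC_mul_mem_map_includeRight_iff`), transported to any ring isomorphic to the tensor
   product (`extReesBC_mem_map_colon_of_mul_mem`);
6. the universal property of the pushout, ring-theoretically: the `A'`-algebra map
   `e : A' ⊗[A] S → S'`, `a' ⊗ x ↦ a' ψ x` (`Algebra.TensorProduct.lift`) is injective because
   `A' ⊗[A] S → A' ⊗[A] A[t, t⁻¹] ≅ A'[t, t⁻¹]` is (`Module.Flat.lTensor_preserves_injective_linearMap`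
   and `AddMonoidAlgebra.scalarTensorEquiv`), and surjective because `S'` is generated over `A'`
   by `t⁻¹ = ψ t⁻¹` and the `a' tⁿ` of 4 (`Algebra.adjoin_induction`); a pair of ring maps
   `α : A' → Q`, `β : S → Q` agreeing on `A` factors as `(lift α β) ∘ e⁻¹`, uniquely since `e` is
   onto.
-/

set_option linter.dupNamespace false -- mandated namespace of this single-conjunct summit

namespace Summit.ResolutionOfSingularities.ResolutionOfSingularities.Theorems

open CategoryTheory AlgebraicGeometry TopologicalSpace Literature.AlgebraicGeometry.Resolution
open scoped LaurentPolynomial TensorProduct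
open LaurentPolynomial

/-! ## Colon submodules and ideals under a flat base change -/

section FlatColon

/-- **Flat base change commutes with preimages of submodules.** For a flat `R`-module `M`, an
`R`-linear endomorphism `f` of `N` and a submodule `J ≤ N`, an element `z ∈ M ⊗ N` lies in the
image of `M ⊗ f⁻¹(J)` iff `(1 ⊗ f) z` lies in the image of `M ⊗ J` (tensor the exact sequence
`0 → f⁻¹(J) → N → N/J`, which stays exact by flatness, and use right exactness for `N/J`).
[folklore] -/
theorem extReesBC_mem_range_lTensor_comap_iff {R M N : Type*} [CommRing R] [AddCommGroup M]
    [Module R M] [Module.Flat R M] [AddCommGroup N] [Module R N] (f : N →ₗ[R] N)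
    (J : Submodule R N) (z : M ⊗[R] N) :
    z ∈ LinearMap.range ((J.comap f).subtype.lTensor M) ↔
      f.lTensor M z ∈ LinearMap.range (J.subtype.lTensor M) := by
  have hex : Function.Exact (J.comap f).subtype (J.mkQ ∘ₗ f) := by
    rw [LinearMap.exact_iff, LinearMap.ker_comp, Submodule.ker_mkQ, Submodule.range_subtype]
  rw [← LinearMap.exact_iff.mp (Module.Flat.lTensor_exact M hex), LinearMap.mem_ker,
    LinearMap.lTensor_comp_apply, ← LinearMap.mem_ker, lTensor_mkQ]

/-- **Colon ideals commute with flat base change** (inside `R' ⊗[R] B`). For a flat `R`-algebra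
`R'`, an `R`-algebra `B`, an ideal `J ≤ B` and `s ∈ B`: `(1 ⊗ s) · z ∈ J · (R' ⊗ B)` iff
`z ∈ (J : s) · (R' ⊗ B)`. [folklore] -/
theorem extReesBC_mul_mem_map_includeRight_iff {R R' B : Type*} [CommRing R] [CommRing R']
    [Algebra R R'] [Module.Flat R R'] [CommRing B] [Algebra R B] (J : Ideal B) (s : B)
    (z : R' ⊗[R] B) :
    (1 ⊗ₜ[R] s) * z ∈ J.map (Algebra.TensorProduct.includeRight : B →ₐ[R] R' ⊗[R] B) ↔
      z ∈ (J.colon {s}).map (Algebra.TensorProduct.includeRight : B →ₐ[R] R' ⊗[R] B) := by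
  have h1 : ∀ (K : Ideal B) (w : R' ⊗[R] B),
      w ∈ K.map (Algebra.TensorProduct.includeRight : B →ₐ[R] R' ⊗[R] B) ↔
        w ∈ LinearMap.range ((K.restrictScalars R).subtype.lTensor R') := by
    intro K w
    rw [← Ideal.map_includeRight_eq, Submodule.restrictScalars_mem]
  rw [h1, h1]
  have hK : (J.colon {s}).restrictScalars R =
      (J.restrictScalars R).comap (LinearMap.mulLeft R s) := by
    ext g
    simp only [Submodule.restrictScalars_mem, Submodule.mem_colon_singleton, Submodule.mem_comap,
      LinearMap.mulLeft_apply, smul_eq_mul, mul_comm g s]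
  have hz : (LinearMap.mulLeft R s).lTensor R' z = (1 ⊗ₜ[R] s) * z := by
    induction z using TensorProduct.induction_on with
    | zero => simp
    | tmul a x => simp [Algebra.TensorProduct.tmul_mul_tmul]
    | add x y hx hy => simp [mul_add, hx, hy]
  rw [hK, extReesBC_mem_range_lTensor_comap_iff, hz]

/-- **Colon ideals commute with flat base change** (transported to any ring `B'` identified with
`R' ⊗[R] B` by a ring isomorphism `e` under which `ψ : B → B'` is `b ↦ 1 ⊗ b`): if
`ψ s · g ∈ J B'` then `g ∈ (J : s) B'`. [folklore] -/
theorem extReesBC_mem_map_colon_of_mul_mem {R R' B B' : Type*} [CommRing R] [CommRing R']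
    [Algebra R R'] [Module.Flat R R'] [CommRing B] [Algebra R B] [CommRing B']
    (e : R' ⊗[R] B ≃+* B') (ψ : B →+* B') (he : ∀ x, e (1 ⊗ₜ[R] x) = ψ x)
    (J : Ideal B) (s : B) {g : B'} (hg : ψ s * g ∈ J.map ψ) : g ∈ (J.colon {s}).map ψ := by
  set ι := (Algebra.TensorProduct.includeRight : B →ₐ[R] R' ⊗[R] B) with hι
  -- `J B'` pulls back to `J (R' ⊗ B)` under `e⁻¹`
  have h1 : J.map ψ ≤ (J.map ι).comap ((e.symm : B' ≃+* R' ⊗[R] B) : B' →+* R' ⊗[R] B) := by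
    rw [Ideal.map_le_iff_le_comap]
    intro j hj
    rw [Ideal.mem_comap, Ideal.mem_comap, RingHom.coe_coe, ← he, RingEquiv.symm_apply_apply]
    exact Ideal.mem_map_of_mem ι hj
  -- `(J : s) (R' ⊗ B)` pushes forward into `(J : s) B'` under `e`
  have h2 : (J.colon {s}).map ι ≤ ((J.colon {s}).map ψ).comap (e : R' ⊗[R] B →+* B') := by
    rw [Ideal.map_le_iff_le_comap]
    intro k hk
    rw [Ideal.mem_comap, Ideal.mem_comap, RingHom.coe_coe, hι,
      Algebra.TensorProduct.includeRight_apply, he]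
    exact Ideal.mem_map_of_mem ψ hk
  have h3 : (1 ⊗ₜ[R] s) * e.symm g ∈ J.map ι := by
    have := h1 hg
    rwa [Ideal.mem_comap, RingHom.coe_coe, map_mul, ← he, RingEquiv.symm_apply_apply] at this
  have h5 := h2 ((extReesBC_mul_mem_map_includeRight_iff J s (e.symm g)).mp h3)
  rwa [Ideal.mem_comap, RingHom.coe_coe, RingEquiv.apply_symm_apply] at h5

end FlatColon

/-! ## The base change map `ψ` and the identification `A' ⊗[A] A[t⁻¹, Iₙ tⁿ] ≅ A'[t⁻¹, I'ₙ tⁿ]` -/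

section BaseChange

variable {A A' : Type} [CommRing A] [CommRing A'] [Algebra A A']
  (I : ℕ → Ideal A) (I' : ℕ → Ideal A') (ψ : extReesAlgebra I →+* extReesAlgebra I')
  (hψ : ∀ x : extReesAlgebra I, ((ψ x : extReesAlgebra I') : A'[T;T⁻¹]) =
    AddMonoidAlgebra.mapRingHom ℤ (algebraMap A A') (x : A[T;T⁻¹]))

variable (f : A' ⊗[A] extReesAlgebra I →ₐ[A'] extReesAlgebra I')
  (hf : ∀ (a : A') (x : extReesAlgebra I),
    f (a ⊗ₜ[A] x) = algebraMap A' (extReesAlgebra I') a * ψ x)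

include hψ hf in
/-- An `A'`-algebra map `f : A' ⊗[A] A[t⁻¹, Iₙ tⁿ] → A'[t⁻¹, I'ₙ tⁿ]` with `f (a' ⊗ x) = a' ψ x`,
followed by the inclusion into `A'[t, t⁻¹]`, is the base change of the inclusion
`A[t⁻¹, Iₙ tⁿ] ⊆ A[t, t⁻¹]` followed by `A' ⊗[A] A[t, t⁻¹] ≅ A'[t, t⁻¹]`. [folklore] -/
theorem extReesBC_coe_apply (z : A' ⊗[A] extReesAlgebra I) :
    ((f z : extReesAlgebra I') : A'[T;T⁻¹]) =
      AddMonoidAlgebra.scalarTensorEquiv A A'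
        (((extReesAlgebra I).val.toLinearMap).lTensor A' z) := by
  induction z using TensorProduct.induction_on with
  | zero => simp
  | tmul a x =>
    simp only [hf, LinearMap.lTensor_tmul, AlgHom.toLinearMap_apply,
      Subalgebra.coe_val, AddMonoidAlgebra.scalarTensorEquiv_tmul, MulMemClass.coe_mul,
      Subalgebra.coe_algebraMap, hψ, Algebra.smul_def]
    rfl
  | add x y hx hy => rw [map_add, AddMemClass.coe_add, hx, hy, map_add, map_add]

include hψ hf in
/-- **`A' ⊗[A] A[t⁻¹, Iₙ tⁿ] → A'[t⁻¹, I'ₙ tⁿ]`, `a' ⊗ x ↦ a' ψ x`, is injective for `A'` flat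
over `A`**: it embeds into the injection `A' ⊗[A] A[t⁻¹, Iₙ tⁿ] ↪ A' ⊗[A] A[t, t⁻¹] ≅ A'[t, t⁻¹]`
(`Module.Flat.lTensor_preserves_injective_linearMap`). [folklore] -/
theorem extReesBC_injective [Module.Flat A A'] : Function.Injective f := by
  intro z₁ z₂ h
  have h' := congrArg (fun y : extReesAlgebra I' => (y : A'[T;T⁻¹])) h
  simp only [extReesBC_coe_apply I I' ψ hψ f hf] at h'
  exact Module.Flat.lTensor_preserves_injective_linearMap _ (fun x y hxy => Subtype.ext hxy)
    ((AddMonoidAlgebra.scalarTensorEquiv A A').injective h')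

include hψ in
/-- Generation over `A'`: an `A'`-submodule of `A'[t⁻¹, I'ₙ tⁿ]` containing the images
`ψ (a tⁿ)` (`a ∈ Iₙ`) contains every `a' tⁿ` with `a' ∈ Iₙ A'` (span induction: `Iₙ A'` is the
`A'`-span of the image of `Iₙ`). [folklore] -/
theorem extReesBC_mem_of_coe_eq (M : Submodule A' (extReesAlgebra I')) {n : ℕ} (hn : 0 < n)
    (hle : (I n).map (algebraMap A A') ≤ I' n)
    (hM : ∀ (a : A) (ha : a ∈ I n),
      ψ ⟨C a * T (n : ℤ), extReesAlgebra.C_mul_T_mem I hn ha⟩ ∈ M)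
    {a' : A'} (ha' : a' ∈ (I n).map (algebraMap A A')) :
    ∀ y : extReesAlgebra I', (y : A'[T;T⁻¹]) = C a' * T (n : ℤ) → y ∈ M := by
  have hle' : ∀ {x : A'}, x ∈ Submodule.span A' (algebraMap A A' '' (I n : Set A)) → x ∈ I' n :=
    fun hx => hle (by rwa [Ideal.map, ← Ideal.submodule_span_eq])
  rw [Ideal.map, ← Ideal.submodule_span_eq] at ha'
  induction ha' using Submodule.span_induction with
  | mem x hx =>
    obtain ⟨a, ha, rfl⟩ := hx
    intro y hy
    have : y = ψ ⟨C a * T (n : ℤ), extReesAlgebra.C_mul_T_mem I hn ha⟩ := by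
      apply Subtype.ext
      rw [hy, hψ]
      change _ = AddMonoidAlgebra.mapRingHom ℤ (algebraMap A A') (C a * T (n : ℤ))
      rw [map_mul, extReesLoc_mapRingHom_C, extReesLoc_mapRingHom_T]
    rw [this]
    exact hM a ha
  | zero =>
    intro y hy
    rw [map_zero, zero_mul, ZeroMemClass.coe_eq_zero] at hy
    exact hy ▸ M.zero_mem
  | add x₁ x₂ hx₁ hx₂ ih₁ ih₂ =>
    intro y hy
    have : y = (⟨C x₁ * T (n : ℤ), extReesAlgebra.C_mul_T_mem I' hn (hle' hx₁)⟩ :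
        extReesAlgebra I') + ⟨C x₂ * T (n : ℤ), extReesAlgebra.C_mul_T_mem I' hn (hle' hx₂)⟩ :=
      Subtype.ext (by rw [AddMemClass.coe_add, hy, map_add, add_mul])
    rw [this]
    exact M.add_mem (ih₁ _ rfl) (ih₂ _ rfl)
  | smul r x hx ih =>
    intro y hy
    have : y = r • (⟨C x * T (n : ℤ), extReesAlgebra.C_mul_T_mem I' hn (hle' hx)⟩ :
        extReesAlgebra I') := Subtype.ext (by
      rw [Subalgebra.coe_smul, hy, smul_eq_mul, Algebra.smul_def, ← C_eq_algebraMap, map_mul,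
        mul_assoc])
    rw [this]
    exact M.smul_mem r (ih _ rfl)

include hψ in
/-- The vertex ideal of `A'[t⁻¹, I'ₙ tⁿ]` is generated by the image of the vertex ideal of
`A[t⁻¹, Iₙ tⁿ]`, as soon as `I'ₙ = Iₙ A'` (no flatness needed). [folklore] -/
theorem extReesBC_vertexIdeal_le_map (heq : ∀ n, I' n = (I n).map (algebraMap A A')) :
    extReesAlgebra.vertexIdeal I' ≤ (extReesAlgebra.vertexIdeal I).map ψ := by
  apply Ideal.span_le.mpr
  rintro x' ⟨n, hn, a', ha', hx'⟩
  rw [heq n] at ha'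
  exact extReesBC_mem_of_coe_eq I I' ψ hψ
    (((extReesAlgebra.vertexIdeal I).map ψ).restrictScalars A') hn (heq n).ge
    (fun a ha => Ideal.mem_map_of_mem ψ (Ideal.subset_span ⟨n, hn, a, ha, rfl⟩)) ha' x' hx'

include hψ hf in
/-- **`A' ⊗[A] A[t⁻¹, Iₙ tⁿ] → A'[t⁻¹, I'ₙ tⁿ]`, `a' ⊗ x ↦ a' ψ x`, is surjective** when
`I'ₙ = Iₙ A'`: the target is generated over `A'` by `t⁻¹ = ψ t⁻¹` and the `a' tⁿ`, `a' ∈ Iₙ A'`,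
which are `A'`-combinations of the `ψ (a tⁿ)`. [folklore] -/
theorem extReesBC_surjective (heq : ∀ n, I' n = (I n).map (algebraMap A A')) :
    Function.Surjective f := by
  rintro ⟨p, hp⟩
  induction hp using Algebra.adjoin_induction with
  | mem x hx =>
    rcases hx with rfl | ⟨n, hn, a', ha', rfl⟩
    · refine ⟨1 ⊗ₜ extReesAlgebra.tInv I, ?_⟩
      rw [hf, map_one, one_mul, strictTransformLoc_map_tInv I I' ψ hψ]
      rfl
    · have ha'' : a' ∈ (I n).map (algebraMap A A') := heq n ▸ ha'
      obtain ⟨z, hz⟩ := LinearMap.mem_range.mp (extReesBC_mem_of_coe_eq I I' ψ hψ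
        (LinearMap.range f.toLinearMap) hn (heq n).ge
        (fun a ha => LinearMap.mem_range.mpr
          ⟨1 ⊗ₜ _, by rw [AlgHom.toLinearMap_apply, hf, map_one, one_mul]⟩)
        ha'' ⟨C a' * T (n : ℤ), extReesAlgebra.C_mul_T_mem I' hn ha'⟩ rfl)
      exact ⟨z, hz⟩
  | algebraMap r =>
    exact ⟨algebraMap A' _ r, Subtype.ext (by rw [AlgHom.commutes, Subalgebra.coe_algebraMap])⟩
  | add x y _ _ ihx ihy =>
    obtain ⟨⟨z₁, h₁⟩, ⟨z₂, h₂⟩⟩ := And.intro ihx ihy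
    exact ⟨z₁ + z₂, by rw [map_add, h₁, h₂]; rfl⟩
  | mul x y _ _ ihx ihy =>
    obtain ⟨⟨z₁, h₁⟩, ⟨z₂, h₂⟩⟩ := And.intro ihx ihy
    exact ⟨z₁ * z₂, by rw [map_mul, h₁, h₂]; rfl⟩

include hψ in
/-- **`A'[t⁻¹, I'ₙ tⁿ] = A' ⊗[A] A[t⁻¹, Iₙ tⁿ]` for `A'` flat over `A` and `I'ₙ = Iₙ A'`**: there
is an isomorphism of `A'`-algebras `e` with `e (a' ⊗ x) = a' ψ x` (the `A'`-algebra map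
`Algebra.TensorProduct.lift` of `A' → A'[t⁻¹, I'ₙ tⁿ]` and `ψ`, bijective by the two previous
lemmas). [folklore] -/
theorem extReesBC_exists_algEquiv [Module.Flat A A']
    (heq : ∀ n, I' n = (I n).map (algebraMap A A')) :
    ∃ e : A' ⊗[A] extReesAlgebra I ≃ₐ[A'] extReesAlgebra I',
      ∀ (a : A') (x : extReesAlgebra I),
        e (a ⊗ₜ[A] x) = algebraMap A' (extReesAlgebra I') a * ψ x := by
  let ψA : extReesAlgebra I →ₐ[A] extReesAlgebra I' :=
    { ψ with
      commutes' := fun a => by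
        show ψ (algebraMap A (extReesAlgebra I) a) = algebraMap A (extReesAlgebra I') a
        rw [IsScalarTower.algebraMap_apply A A' (extReesAlgebra I')]
        exact strictTransformLoc_map_algebraMap I I' ψ hψ a }
  let f : A' ⊗[A] extReesAlgebra I →ₐ[A'] extReesAlgebra I' :=
    Algebra.TensorProduct.lift (Algebra.ofId A' (extReesAlgebra I')) ψA fun _ _ => Commute.all _ _
  have hf : ∀ (a : A') (x : extReesAlgebra I),
      f (a ⊗ₜ[A] x) = algebraMap A' (extReesAlgebra I') a * ψ x :=
    fun a x => Algebra.TensorProduct.lift_tmul ..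
  exact ⟨AlgEquiv.ofBijective f
    ⟨extReesBC_injective I I' ψ hψ f hf, extReesBC_surjective I I' ψ hψ f hf heq⟩, hf⟩

include hψ in
/-- **Strict transforms commute with flat base change** (the inclusion needing flatness): with
`S = A[t⁻¹, Iₙ tⁿ]`, `S' = A'[t⁻¹, I'ₙ tⁿ] = A' ⊗[A] S`, the `t⁻¹`-saturation of `𝔞 A' S'`
is generated by the image of the `t⁻¹`-saturation of `𝔞 S`, because colon ideals by powers of
`t⁻¹` commute with the flat base change `S → S'`. [folklore] -/
theorem extReesBC_strictTransform_le_map [Module.Flat A A']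
    (heq : ∀ n, I' n = (I n).map (algebraMap A A')) (𝔞 : Ideal A) :
    extReesAlgebra.strictTransform I' (𝔞.map (algebraMap A A')) ≤
      (extReesAlgebra.strictTransform I 𝔞).map ψ := by
  intro g' hg'
  obtain ⟨m, hm⟩ := (extReesAlgebra.mem_strictTransform_iff I').mp hg'
  rw [← strictTransformLoc_map_map I I' ψ hψ, ← strictTransformLoc_map_tInv I I' ψ hψ,
    ← map_pow] at hm
  obtain ⟨e, he⟩ := extReesBC_exists_algEquiv I I' ψ hψ heq
  have h := extReesBC_mem_map_colon_of_mul_mem e.toRingEquiv ψ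
    (fun x => by
      show e (1 ⊗ₜ x) = ψ x
      rw [he, map_one, one_mul]) _ _ hm
  refine Ideal.map_mono ?_ h
  intro g hg
  rw [Submodule.mem_colon_singleton, smul_eq_mul, mul_comm] at hg
  exact (extReesAlgebra.mem_strictTransform_iff I).mpr ⟨m, hg⟩

include hψ in
/-- **Universal property**: `A'[t⁻¹, I'ₙ tⁿ]` is the pushout of `A → A'` and
`A → A[t⁻¹, Iₙ tⁿ]` (ring-theoretically), for `A'` flat over `A` and `I'ₙ = Iₙ A'`. [folklore] -/
theorem extReesBC_universal [Module.Flat A A']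
    (heq : ∀ n, I' n = (I n).map (algebraMap A A')) (Q : Type) [CommRing Q] (α : A' →+* Q)
    (β : extReesAlgebra I →+* Q)
    (hαβ : α.comp (algebraMap A A') = β.comp (algebraMap A (extReesAlgebra I))) :
    ∃! γ : extReesAlgebra I' →+* Q,
      γ.comp (algebraMap A' (extReesAlgebra I')) = α ∧ γ.comp ψ = β := by
  letI : Algebra A Q := (β.comp (algebraMap A (extReesAlgebra I))).toAlgebra
  let αA : A' →ₐ[A] Q :=
    { α with
      commutes' := fun r => by
        show α (algebraMap A A' r) = β (algebraMap A (extReesAlgebra I) r)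
        exact RingHom.congr_fun hαβ r }
  let βA : extReesAlgebra I →ₐ[A] Q := { β with commutes' := fun _ => rfl }
  let δ : A' ⊗[A] extReesAlgebra I →ₐ[A] Q :=
    Algebra.TensorProduct.lift αA βA fun _ _ => Commute.all _ _
  have hδ : ∀ a x, δ (a ⊗ₜ x) = α a * β x := fun a x => Algebra.TensorProduct.lift_tmul ..
  obtain ⟨e, he⟩ := extReesBC_exists_algEquiv I I' ψ hψ heq
  have he₁ : ∀ a, e.symm (algebraMap A' (extReesAlgebra I') a) = a ⊗ₜ 1 := fun a => by
    rw [AlgEquiv.symm_apply_eq, he, map_one, mul_one]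
  have he₂ : ∀ x, e.symm (ψ x) = 1 ⊗ₜ x := fun x => by
    rw [AlgEquiv.symm_apply_eq, he, map_one, one_mul]
  let γ : extReesAlgebra I' →+* Q := δ.toRingHom.comp (e.symm : extReesAlgebra I' →+* _)
  have hγ : ∀ y, γ y = δ (e.symm y) := fun _ => rfl
  refine ⟨γ, ⟨?_, ?_⟩, ?_⟩
  · ext a
    rw [RingHom.comp_apply, hγ, he₁, hδ, map_one, mul_one]
  · ext x
    rw [RingHom.comp_apply, hγ, he₂, hδ, map_one, one_mul]
  · rintro γ' ⟨h₁, h₂⟩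
    apply RingHom.ext
    intro y
    obtain ⟨z, rfl⟩ := e.surjective y
    rw [hγ, AlgEquiv.symm_apply_apply]
    induction z using TensorProduct.induction_on with
    | zero => rw [map_zero, map_zero, map_zero]
    | tmul a x =>
      rw [he, map_mul, hδ, ← h₁, ← h₂]
      rfl
    | add x y hx hy => rw [map_add, map_add, hx, hy, map_add]

end BaseChange

/-- **Extended Rees algebras base-change along flat algebras** (the full cobordant blow-up
`B = Spec A[t⁻¹, Iₙ tⁿ]`, Włodarczyk, arXiv:2203.03090, Def. 2.3.5 and App. Def. 5.1.1, commutes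
with flat base change, e.g. extension of the ground field). For a flat `A`-algebra `A'` and
`I'ₙ = Iₙ A'`, the base change of Laurent polynomials restricts to a ring map
`ψ : A[t⁻¹, Iₙ tⁿ] → A'[t⁻¹, I'ₙ tⁿ]` over `A → A'` which maps `t⁻¹` to `t⁻¹`, the vertex ideal
onto the vertex ideal and every strict transform `σˢ(𝔞)` onto `σˢ(𝔞 A')` (saturation commutes
with flat base change), and which exhibits `A'[t⁻¹, I'ₙ tⁿ]` as the pushout
`A' ⊗_A A[t⁻¹, Iₙ tⁿ]` (universal property among commutative rings). Consumed by the line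
`support-first-weights-second` through `stub_cobordantPlus_baseChange` (the scheme statement).
[cite: Wlodarczyk2022, Def. 5.1.1] -/
theorem stub_extReesAlgebra_baseChange :
    ∀ {A A' : Type} [CommRing A] [CommRing A'] [Algebra A A'] [Module.Flat A A']
      (I : ℕ → Ideal A) (I' : ℕ → Ideal A'), (∀ n, I' n = (I n).map (algebraMap A A')) →
      ∃ ψ : extReesAlgebra I →+* extReesAlgebra I',
        (∀ x : extReesAlgebra I, ((ψ x : extReesAlgebra I') : A'[T;T⁻¹]) =
            AddMonoidAlgebra.mapRingHom ℤ (algebraMap A A') (x : A[T;T⁻¹])) ∧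
        ψ.comp (algebraMap A (extReesAlgebra I)) =
          (algebraMap A' (extReesAlgebra I')).comp (algebraMap A A') ∧
        ψ (extReesAlgebra.tInv I) = extReesAlgebra.tInv I' ∧
        (extReesAlgebra.vertexIdeal I).map ψ = extReesAlgebra.vertexIdeal I' ∧
        (∀ 𝔞 : Ideal A, (extReesAlgebra.strictTransform I 𝔞).map ψ =
          extReesAlgebra.strictTransform I' (𝔞.map (algebraMap A A'))) ∧
        (∀ (Q : Type) [CommRing Q] (α : A' →+* Q) (β : extReesAlgebra I →+* Q),
          α.comp (algebraMap A A') = β.comp (algebraMap A (extReesAlgebra I)) →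
          ∃! γ : extReesAlgebra I' →+* Q, γ.comp (algebraMap A' (extReesAlgebra I')) = α ∧ γ.comp ψ = β) := by
  intro A A' _ _ _ _ I I' heq
  have hle : ∀ n, (I n).map (algebraMap A A') ≤ I' n := fun n => (heq n).ge
  let ψ : extReesAlgebra I →+* extReesAlgebra I' :=
    (AddMonoidAlgebra.mapRingHom ℤ (algebraMap A A')).restrict (extReesAlgebra I)
      (extReesAlgebra I') fun _ hp => extReesLoc_mapRingHom_mem I I' hle hp
  have hψ : ∀ x : extReesAlgebra I, ((ψ x : extReesAlgebra I') : A'[T;T⁻¹]) =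
      AddMonoidAlgebra.mapRingHom ℤ (algebraMap A A') (x : A[T;T⁻¹]) := fun _ => rfl
  refine ⟨ψ, hψ, ?_, strictTransformLoc_map_tInv I I' ψ hψ, ?_, fun 𝔞 => ?_,
    fun Q _ α β hαβ => ?_⟩
  · exact RingHom.ext fun a => strictTransformLoc_map_algebraMap I I' ψ hψ a
  · exact le_antisymm (strictTransformLoc_vertexIdeal_map_le I I' ψ hψ hle)
      (extReesBC_vertexIdeal_le_map I I' ψ hψ heq)
  · exact le_antisymm (strictTransformLoc_strictTransform_map_le I I' ψ hψ 𝔞)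
      (extReesBC_strictTransform_le_map I I' ψ hψ heq 𝔞)
  · exact extReesBC_universal I I' ψ hψ heq Q α β hαβ

end Summit.ResolutionOfSingularities.ResolutionOfSingularities.Theorems
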